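import Mathlib.Analysis.InnerProductSpace.Projection.Basic
import Mathlib.MeasureTheory.Function.AEEqOfIntegral
import Mathlib.MeasureTheory.Function.L2Space
import Literature.NumberTheory.ConnesConsani2021.ArchimedeanSoninTrace
import HarnessLib

/-!
# Connes–Consani 2021 — Sonin's space is closed; the orthogonal projection `𝐒` (Theorem 4.7, the operator)

A. Connes, C. Consani, *Weil positivity and trace formula, the archimedean place*, Selecta Math.
(N.S.) 27 (2021) 77 (= arXiv:2006.13771) [bib: `ConnesConsani2021`], §4 Definition 4.4 and
Theorem 4.7 (p. 18): "Let `𝐒` be the orthogonal projection of `L²(ℝ)_ev` onto the [closed,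
infinite-dimensional] subspace `S(1,1)` of even functions which vanish as well as their Fourier
transform in the interval `[-1, 1]`" (the wording also of Thm. 6.11, §6.7 p. 28).  The statement
layer `ArchimedeanSoninTrace.lean` types `S(α,β)` as a submodule `soninSpace α β` of Mathlib's `L²(ℝ)`
and describes `𝐒` in prose.  Here (cell `pub-rhdoor`, seat cc-2; PROVED, no named fact):

* `isClosed_soninSpace` — `S(α, β)` is CLOSED in `L²(ℝ)`: a.e.-evenness is the fixed space of the
  isometry `ξ ↦ ξ ∘ (−)`; vanishing a.e. on `[-α, α]` (resp. of `𝓕ξ` on `[-β, β]`) is the intersection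
  of the kernels of the continuous functionals `ξ ↦ ⟪𝟙_A, ξ⟫ = ∫_A ξ` over measurable `A ⊆ [-α, α]`
  (resp. composed with the continuous `L²` Fourier transform `𝓕`).
* hence `S(α,β)` is complete and has an orthogonal projection; **`soninProjection α β` = `𝐒`**, the
  orthogonal projection of `L²(ℝ)` onto `S(α, β)` as a bounded operator `L²(ℝ) →L[ℂ] L²(ℝ)` (Mathlib
  `Submodule.starProjection`): idempotent, symmetric, with fixed space exactly `S(α,β)`
  (`soninProjection_mem`, `soninProjection_eq_self_iff`, `soninProjection_idem`,
  `soninProjection_isSymmetric`).  CC project from `L²(ℝ)_ev`; projecting from all of `L²(ℝ)` onto the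
  same closed subspace `S ⊆ L²(ℝ)_ev` restricts to their `𝐒` on `L²(ℝ)_ev` (and kills odd functions).

Deliberately NOT here: "infinite-dimensional" (Sonin 1880; needs explicit Sonin functions), the trace
formula of Thm. 4.7, the prolate operators.
-/

noncomputable section

open _root_.MeasureTheory Complex Set FourierTransform
open scoped Real ComplexConjugate InnerProductSpace ENNReal

namespace Literature.NumberTheory.ConnesConsani2021

open Literature.NumberTheory.LFunctions

/-! ## The three defining conditions of `S(α, β)` are closed in `L²(ℝ)` -/

/-- Reflection `ξ ↦ ξ ∘ (x ↦ −x)` as a linear isometry of `L²(ℝ)` (Lebesgue measure is even). [folklore] -/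
private def reflectL2 : Lp ℂ 2 (volume : Measure ℝ) →ₗᵢ[ℂ] Lp ℂ 2 (volume : Measure ℝ) :=
  Lp.compMeasurePreservingₗᵢ ℂ (fun x : ℝ => -x) (Measure.measurePreserving_neg (volume : Measure ℝ))

/-- `reflectL2 ξ = ξ ∘ (−)` a.e. [folklore] -/
private theorem coeFn_reflectL2 (ξ : Lp ℂ 2 (volume : Measure ℝ)) :
    (reflectL2 ξ : ℝ → ℂ) =ᵐ[volume] fun x => (ξ : ℝ → ℂ) (-x) :=
  Lp.coeFn_compMeasurePreserving ξ (Measure.measurePreserving_neg (volume : Measure ℝ))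

/-- Evenness a.e. is the fixed-point condition of the reflection isometry. [folklore] -/
private theorem even_iff_reflectL2_eq (ξ : Lp ℂ 2 (volume : Measure ℝ)) :
    (∀ᵐ x : ℝ, (ξ : ℝ → ℂ) (-x) = (ξ : ℝ → ℂ) x) ↔ reflectL2 ξ = ξ := by
  constructor
  · intro h
    exact Lp.ext ((coeFn_reflectL2 ξ).trans h)
  · intro h
    have h1 := coeFn_reflectL2 ξ
    rw [h] at h1
    filter_upwards [h1] with x hx
    exact hx.symm

/-- The set of a.e.-even `L²` functions is closed. [folklore] -/
private theorem isClosed_setOf_even :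
    IsClosed {ξ : Lp ℂ 2 (volume : Measure ℝ) | ∀ᵐ x : ℝ, (ξ : ℝ → ℂ) (-x) = (ξ : ℝ → ℂ) x} := by
  have : {ξ : Lp ℂ 2 (volume : Measure ℝ) | ∀ᵐ x : ℝ, (ξ : ℝ → ℂ) (-x) = (ξ : ℝ → ℂ) x} =
      {ξ | reflectL2 ξ = ξ} :=
    Set.ext fun ξ => even_iff_reflectL2_eq ξ
  rw [this]
  exact isClosed_eq reflectL2.continuous continuous_id

/-- The set of `L²` functions vanishing a.e. on `[-a, a]` is closed: it is the intersection, over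
measurable `A ⊆ [-a, a]`, of the kernels of the continuous functionals `ξ ↦ ⟪𝟙_A, ξ⟫ = ∫_A ξ`.
[folklore] -/
private theorem isClosed_setOf_ae_zero_on (a : ℝ) :
    IsClosed {ξ : Lp ℂ 2 (volume : Measure ℝ) | ∀ᵐ x : ℝ, x ∈ Icc (-a) a → (ξ : ℝ → ℂ) x = 0} := by
  have hI : MeasurableSet (Icc (-a) a) := measurableSet_Icc
  have hfin : ∀ A : Set ℝ, A ⊆ Icc (-a) a → volume A ≠ ∞ := fun A hA =>
    (lt_of_le_of_lt (measure_mono hA) measure_Icc_lt_top).ne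
  have key : {ξ : Lp ℂ 2 (volume : Measure ℝ) | ∀ᵐ x : ℝ, x ∈ Icc (-a) a → (ξ : ℝ → ℂ) x = 0} =
      ⋂ (A : Set ℝ) (hA : MeasurableSet A) (hAI : A ⊆ Icc (-a) a),
        {ξ : Lp ℂ 2 (volume : Measure ℝ) |
          ⟪indicatorConstLp 2 hA (hfin A hAI) (1 : ℂ), ξ⟫_ℂ = 0} := by
    ext ξ
    simp only [Set.mem_setOf_eq, Set.mem_iInter]
    constructor
    · intro h A hA hAI
      rw [L2.inner_indicatorConstLp_one]
      refine setIntegral_eq_zero_of_ae_eq_zero ?_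
      filter_upwards [h] with x hx hxA using hx (hAI hxA)
    · intro h
      haveI : IsFiniteMeasure ((volume : Measure ℝ).restrict (Icc (-a) a)) :=
        ⟨by rw [Measure.restrict_apply_univ]; exact measure_Icc_lt_top⟩
      have hint : Integrable (ξ : ℝ → ℂ) ((volume : Measure ℝ).restrict (Icc (-a) a)) :=
        ((Lp.memLp ξ).restrict (Icc (-a) a)).integrable one_le_two
      have hz := hint.ae_eq_zero_of_forall_setIntegral_eq_zero (fun s hs _ => by
        rw [Measure.restrict_restrict hs]
        have := h (s ∩ Icc (-a) a) (hs.inter hI) inter_subset_right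
        rwa [L2.inner_indicatorConstLp_one] at this)
      rw [Filter.EventuallyEq, ae_restrict_iff' hI] at hz
      filter_upwards [hz] with x hx hxI using hx hxI
  rw [key]
  exact isClosed_iInter fun A => isClosed_iInter fun hA => isClosed_iInter fun hAI =>
    isClosed_eq (continuous_const.inner continuous_id) continuous_const

/-- **Sonin's space `S(α, β)` is a closed subspace of `L²(ℝ)`** (Thm. 4.7 p. 18: `𝐒` projects "onto
the subspace" `S(1,1)`, asserted closed — here PROVED for all `α, β`). [cite: ConnesConsani2021, Thm. 4.7 §4 p. 18] -/
theorem isClosed_soninSpace (α β : ℝ) :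
    IsClosed (soninSpace α β : Set (Lp ℂ 2 (volume : Measure ℝ))) := by
  have hset : (soninSpace α β : Set (Lp ℂ 2 (volume : Measure ℝ))) =
      ({ξ : Lp ℂ 2 (volume : Measure ℝ) | ∀ᵐ x : ℝ, (ξ : ℝ → ℂ) (-x) = (ξ : ℝ → ℂ) x} ∩
        {ξ : Lp ℂ 2 (volume : Measure ℝ) | ∀ᵐ x : ℝ, x ∈ Icc (-α) α → (ξ : ℝ → ℂ) x = 0}) ∩
        (fun ξ : Lp ℂ 2 (volume : Measure ℝ) => (𝓕 ξ : Lp ℂ 2 (volume : Measure ℝ))) ⁻¹'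
          {η : Lp ℂ 2 (volume : Measure ℝ) | ∀ᵐ p : ℝ, p ∈ Icc (-β) β → (η : ℝ → ℂ) p = 0} := by
    ext ξ
    simp only [SetLike.mem_coe, mem_soninSpace_iff, Set.mem_inter_iff, Set.mem_setOf_eq,
      Set.mem_preimage, and_assoc]
  rw [hset]
  exact (isClosed_setOf_even.inter (isClosed_setOf_ae_zero_on α)).inter
    ((isClosed_setOf_ae_zero_on β).preimage continuous_fourier)

/-- `S(α, β)` is complete (a closed subspace of the Hilbert space `L²(ℝ)`), hence admits an orthogonal
projection. [cite: ConnesConsani2021, Thm. 4.7 §4 p. 18] -/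
instance completeSpace_soninSpace (α β : ℝ) : CompleteSpace (soninSpace α β) :=
  (isClosed_soninSpace α β).completeSpace_coe

/-! ## The operator `𝐒` -/

/-- **`𝐒`, the orthogonal projection of `L²(ℝ)` onto Sonin's space `S(α, β)`** (Thm. 4.7 p. 18 and
Thm. 6.11 p. 28, with `α = β = 1`: "the orthogonal projection … onto the subspace of even functions
which vanish as well as their Fourier transform in the interval `[-1,1]`"), as a bounded operator on
`L²(ℝ)` (Mathlib's `Submodule.starProjection` of the closed subspace `soninSpace α β`).
[cite: ConnesConsani2021, Thm. 4.7 §4 p. 18] -/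
def soninProjection (α β : ℝ) : Lp ℂ 2 (volume : Measure ℝ) →L[ℂ] Lp ℂ 2 (volume : Measure ℝ) :=
  (soninSpace α β).starProjection

/-- `𝐒 ξ ∈ S(α, β)`. [cite: ConnesConsani2021, Thm. 4.7 §4 p. 18] -/
theorem soninProjection_mem (α β : ℝ) (ξ : Lp ℂ 2 (volume : Measure ℝ)) :
    soninProjection α β ξ ∈ soninSpace α β := by
  rw [soninProjection, Submodule.starProjection_apply]
  exact Submodule.coe_mem _

/-- `𝐒 ξ = ξ ↔ ξ ∈ S(α, β)`. [cite: ConnesConsani2021, Thm. 4.7 §4 p. 18] -/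
theorem soninProjection_eq_self_iff {α β : ℝ} {ξ : Lp ℂ 2 (volume : Measure ℝ)} :
    soninProjection α β ξ = ξ ↔ ξ ∈ soninSpace α β :=
  Submodule.starProjection_eq_self_iff

/-- `𝐒² = 𝐒`. [cite: ConnesConsani2021, Thm. 4.7 §4 p. 18] -/
theorem soninProjection_idem (α β : ℝ) : IsIdempotentElem (soninProjection α β) :=
  (soninSpace α β).isIdempotentElem_starProjection

/-- `𝐒` is symmetric (self-adjoint): `⟪𝐒 ξ, η⟫ = ⟪ξ, 𝐒 η⟫`. [cite: ConnesConsani2021, Thm. 4.7 §4 p. 18] -/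
theorem soninProjection_isSymmetric (α β : ℝ) :
    (soninProjection α β : Lp ℂ 2 (volume : Measure ℝ) →ₗ[ℂ] Lp ℂ 2 (volume : Measure ℝ)).IsSymmetric :=
  (soninSpace α β).starProjection_isSymmetric

/-- `‖𝐒 ξ‖ ≤ ‖ξ‖`. [cite: ConnesConsani2021, Thm. 4.7 §4 p. 18] -/
theorem norm_soninProjection_le (α β : ℝ) (ξ : Lp ℂ 2 (volume : Measure ℝ)) :
    ‖soninProjection α β ξ‖ ≤ ‖ξ‖ :=
  (soninSpace α β).norm_starProjection_apply_le ξ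

end Literature.NumberTheory.ConnesConsani2021

end
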